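import Literature.NumberTheory.Rogawski1990.CurveThetaHodgeTypeSigned
import HarnessLib

/-!
# [Liu2021, Prop. D.4 (1)] — MULTIPLICITY ONE FOR THE ENDOSCOPIC COHOMOLOGICAL THETA REPRESENTATIONS of the unitary groups `U(H)` IN TWO VARIABLES
# (unitary Shimura CURVES), «at most one» half: AT MOST ONE holomorphic-type [resp. antiholomorphic-type] discrete `P` has finite component
# `σ ≅ ω(λ, ε_a, χ)_f` — the θ-RESTRICTED twins E1θ₂ of E1′₂ `curveCohFinComponentUnique_hol ∕ _antihol` (★ `CurveCohomologicalSpectrum`)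

Topic `NumberTheory/Rogawski1990`; namespace `Literature.NumberTheory.Rogawski1990`.  STATEMENT-ONLY: two closed named facts `def … : Prop` (no `sorry`, no
instance, no notation, no new carrier).  HONEST DEBT: +2 named facts that REPLACE, in the books of the floor-0 programme P5 (`Cruxes/HLiu418/Lines/F0_AlbCm`,
packaged stub `stub_S1_facts`), the STRONGER letter E1′hol₂ ★ `curveCohFinComponentUnique_hol` (at most one hol-type `P` with ANY given irreducible smooth finite
component `σ`): the P5 kernel chain (★ `Theorems/HLiu418S1BettiSliceLinesNoE1`, `stub_L10_of_letters'` :188 ∕ `stub_L01_of_letters'` :310) consumes E1′₂ at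
exactly ONE `σ` — the theta representation `ω⋆_lab` itself (`j = id`) — so these θ-restricted letters are what is USED, and they are what is PRINTED.
`_hol → (this)_hol` and `_antihol → (this)_antihol` are restrictions (★-able in three lines); `(this)_antihol` follows from `(this)_hol` by complex conjugation and
the conjugate partner of the oscillator carrier (★ `Summits/…/Theorems/HLiu418ChiSplittingMirror.exists_conjPartner_omegaAtLine_neg`), exactly as ★
`Theorems/HLiu418E3AntiholOfHol` does for the signed letters E3₂.

SETTING AND TOKENS = those of ★ `CurveThetaHodgeTypeSigned.lean` VERBATIM (imported; binder prefix of the crux letter `S1BettiShape`: `L` CM with `[L:ℚ] ≥ 4`,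
`ι : L →+* ℂ`, `H ∈ M₂(L)` with `formCongr c g (t • H) = diag dV`, signature `(1,1)` at `ι` and definite elsewhere read on `diag dV`, a cone frame
`𝔣 : ConeFrame L H (cmPlace L ι)`, an automorphic measure `μ`; the ω-side data: a reindexing `e₁ : Fin 2 × Fin 1 ≃ Fin n′`, the LABEL `λ` — a CONJUGATE SYMPLECTIC
idèle class character of `L` OF WEIGHT ONE (★ `IsConjugateSymplectic`, ★ `HasWeight L λ 1`; [Liu2021, Rem. 4.2, Def. 4.3]) —, a global hermitian line `a ∈ (L⁺)ˣ`,
a character `χ ∈ Chi`, and the theta carrier `ω(λ, ε_a, χ)_f` realised at the line `⟨a⟩` with the `λ`-splitting `isCompatible_chiSplittingLine … (toHeckeCharacter L λ) …`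
and pulled back to `U(H)(𝔸_{L⁺,f})` along `(finAdelicCongr … g ht hg).symm` — the crux's `ω⋆_lab` TERM at `λ := galConj c μ`, `a := r.toFun ε`, `e₁ := finProdFinEquiv`
(definitionally: the consumers feed `j := ⟨LinearMap.id, fun _ => rfl⟩`, ★ `S1BettiSliceExclusionSigned` :227); Hodge types `P.IsHolCotangentAt₂ ∕ IsAntiholCotangentAt₂`
of ★ `UnitaryCurveCohCotangentForms` §5; `P.HasFinComponent σ` of ★ `UnitaryGroupCohomologicalForms` §4).

THE LETTERS (CLASS **U** — readings of a printed statement; chain spelled out in each docstring):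
* `curveThetaCohFinComponentUnique_hol` (E1θhol₂): if an IRREDUCIBLE SMOOTH `σ` of `U(H)(𝔸_{L⁺,f})` embeds (injective intertwiner `j`) into `ω(λ, ε_a, χ)_f ∘ (frame
  transport)`, then AT MOST ONE discrete automorphic `P` of Hodge type `(1,0)` at `ι` has finite component `σ` (`P`, `P′` such ⇒ `P = P′`).
* `curveThetaCohFinComponentUnique_antihol` (E1θantihol₂): the same for Hodge type `(0,1)`.
READING.  [Liu2021, Prop. D.4 (1)] (FJcycle.tex App. D, p. 130): «Let `π^∞` be an irreducible admissible representation of `G(𝔸^∞)` … (1) If `π^∞` is endoscopic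
cohomological, then `dim Hom_{G(𝔸^∞)}(π^∞, H¹_{(2)}) = 1`; moreover `π^∞ ≅ ω(μ, ε, χ)` for a unique conjugate symplectic `μ` of weight one with `τ′₁ ∈ Φ_μ` …», whose
proof (p. 130–131) computes `m_disc(π^{(1,0)}_∞ ⊗ π^∞) + m_disc(π^{(0,1)}_∞ ⊗ π^∞) = 1` from [Rogawski1990, §11] (Prop. 11.1.1 (a),(b),(d): the packets `ρ(θ)`;
Prop. 11.2.1 (b): `m(π) = ½(1 ± 1) ∈ {0,1}` for `π ∈ ρ(θ)` by the [LabesseLanglands1979] formula; Thm. 11.5.1) transported to the inner form `U(H)` by [Harris1993]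
(«`m_disc(π) = m_disc(θ(π))`», Liu p. 130); by Matsushima ([BorelWallach2000, VII 3.2]; [Liu2021, Lem. D.2]) `H¹_{(2)}[π^∞] = ⊕_{π_∞} m_disc(π_∞ ⊗ π^∞) H¹(𝔤,K;π_∞) ⊗ π^∞`
with `dim H¹(𝔤,K;π^{(1,0)}_∞) = dim H¹(𝔤,K;π^{(0,1)}_∞) = 1`, so «`dim = 1`» says in particular `m_disc(π^{(1,0)}_∞ ⊗ ω_f) ≤ 1` and `m_disc(π^{(0,1)}_∞ ⊗ ω_f) ≤ 1` —
and «multiplicity `≤ 1` of `π^{(1,0)}_∞ ⊗ σ` in `L²_disc`» is, for hol-type `P` with finite component `σ`, EQUIVALENT to «at most one such `P`» (★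
`Summits/…/Theorems/HLiu418E1TwoFaces`: `multiplicity_le_one_of_curveCohFinComponentUnique_hol` ∕ `curveCohFinComponentUnique_hol_of_multiplicity`, [Dixmier1977, §5.4] +
the spectral-projection letter (D₂)).  The weight-one and conjugate-symplectic clauses on `λ` are those of the printed statement (they only WEAKEN the letter).
WHY IT MIGHT FAIL: only through a typing slip in the carrier (it is the crux's `ω⋆_lab` term, kernel-matched by the consumers); mathematically it is implied by
multiplicity one for `U(H)` ([Rogawski1990, §11 + §14.6], E1₂ ★-typed `curveMultiplicityLeOne`) via ★ `E1pOfE1` and the restriction.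
Cell `hodgecm-mathlib`, floor-0 programme P5, seat F0P5-p02 (g4).  HC_CM is proved only modulo the printed citations until rung 0 closes; this file discharges none of them.

## References
* [Liu2021] Y. Liu, *Fourier–Jacobi cycles and arithmetic relative trace formula*, Camb. J. Math. 9 (2021) = arXiv:2102.11518: App. D Prop. D.4 (1) and its
  proof (p. 130–131; held chunks p0058 L47 – p0059 L1), Lem. D.2 (p0057), Rem. D.5 (p0059 L5–L12), Rem. 4.2 ∕ Def. 4.3 (weight, CM type of `μ`).
* [Rogawski1990] J. Rogawski, *Automorphic representations of unitary groups in three variables*, Ann. of Math. Stud. 123 (1990), Ch. 11 (held chunks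
  p0152–p0158): Prop. 11.1.1, Prop. 11.2.1, Thm. 11.5.1; §14.6.
* [LabesseLanglands1979] J.-P. Labesse, R. P. Langlands, *L-indistinguishability for SL(2)*, Canad. J. Math. 31 (1979).
* [Harris1993] M. Harris, *L-functions of 2 × 2 unitary groups and factorization of periods of Hilbert modular forms*, J. AMS 6 (1993) (inner transfer).
* [BorelWallach2000] A. Borel, N. Wallach, 2nd ed. (2000), VII 3.2.  [Dixmier1977] J. Dixmier, *C*-algebras* (1977), §5.4.
-/

noncomputable section

open NumberField NumberField.InfinitePlace MeasureTheory IsDedekindDomain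
open scoped Matrix ComplexOrder

namespace Literature.NumberTheory.Rogawski1990

open Literature.NumberTheory.Automorphic Literature.NumberTheory.Automorphic.UnitaryGroup
open Literature.NumberTheory.Automorphic.UnitaryCurveForms
open Literature.NumberTheory.Automorphic.Liu2021 Literature.NumberTheory.Automorphic.Liu2021.Def411WeilCarriers
open Literature.NumberTheory.Automorphic.Liu2021.Def411WeilCarriersDoubling
open Literature.NumberTheory.GaloisRepresentations Literature.NumberTheory.Automorphic.IdeleClassGroup
open Literature.NumberTheory.GelbartRogawski1991 Literature.NumberTheory.GelbartRogawski1991.UnitaryDualPair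
open Literature.RepresentationTheory.Liu2021 Literature.RepresentationTheory.HarrisKudlaSweet1996

/-- **U** (E1θ₂, Hodge type `(1,0)`) **[Liu2021, Prop. D.4 (1)], «at most one» half, holomorphic part: AT MOST ONE `(1,0)`-TYPE DISCRETE `P` OF `U(H)` HAS A
GIVEN THETA FINITE COMPONENT.**  For `L`, `ι`, `H`, the frame `(dV, t, g)`, the signature and definiteness clauses, `𝔣`, `μ` as in ★ `curveThetaHodgeTypeSigned_hol`;
for the ω-side data `e₁`, a conjugate symplectic `λ` of weight one, `a ∈ (L⁺)ˣ`, `χ`; and for an IRREDUCIBLE SMOOTH `σ` of `U(H)(𝔸_{L⁺,f})` with an INJECTIVE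
intertwiner `j : σ → ω(λ, ε_a, χ)_f ∘ (finAdelicCongr … g ht hg).symm`: two discrete automorphic `P`, `P′` both of Hodge type `(1,0)` at `ι` (`IsHolCotangentAt₂ … 𝔣`)
and both with finite component `σ` (`HasFinComponent`) are EQUAL.  READING: «`dim Hom_{G(𝔸^∞)}(π^∞, H¹_{(2)}) = 1` for endoscopic cohomological `π^∞ ≅ ω(μ,ε,χ)`»
[Liu2021, Prop. D.4 (1)] ⊇ «`m_disc(π^{(1,0)}_∞ ⊗ ω_f) ≤ 1`» (proof p. 130–131: [Rogawski1990, Prop. 11.1.1, Prop. 11.2.1 (b), Thm. 11.5.1] + [LabesseLanglands1979]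
on `U(1,1)`, transported by [Harris1993]; Matsushima [BorelWallach2000, VII 3.2], [Liu2021, Lem. D.2]) ⟺ (for hol-type `P` containing `σ`) «at most one such `P`»
([Dixmier1977, §5.4] with the spectral-projection letter (D₂); tree: `Theorems/HLiu418E1TwoFaces`).  Restriction of ★ `curveCohFinComponentUnique_hol` to theta `σ`.
[cite: Liu2021, App. D Prop. D.4 (1) and its proof (p. 130–131); Lem. D.2; Rem. D.5] [cite: Rogawski1990, §11.1 Prop. 11.1.1 (a), (b), (d); Prop. 11.2.1 (b); Thm. 11.5.1]
[cite: BorelWallach2000, VII 3.2] [cite: Dixmier1977, §5.4] -/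
def curveThetaCohFinComponentUnique_hol : Prop :=
  ∀ (L : Type) [Field L] [NumberField L] [IsCMField L] (ι : L →+* ℂ) (H : Matrix (Fin 2) (Fin 2) L)
    (dV : Fin 2 → L) (hdV : ∀ i, IsCMField.complexConj L (dV i) = dV i) (hdV0 : ∀ i, dV i ≠ 0)
    (t : L) (ht : t ≠ 0) (g : GL (Fin 2) L)
    (hg : formCongr ((IsCMField.complexConj L : L ≃ₐ[↥(maximalRealSubfield L)] L) : L →+* L) g (t • H) = Matrix.diagonal dV),
    (∃ T : GL (Fin 2) ℂ, formCongr (starRingEnd ℂ) T ((Matrix.diagonal dV).map ι) = Matrix.diagonal ![(1 : ℂ), -1]) →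
    (∀ τ' : L →+* ℂ, InfinitePlace.mk τ' ≠ InfinitePlace.mk ι → ((Matrix.diagonal dV).map τ').PosDef) →
    4 ≤ Module.finrank ℚ L →
    ∀ (𝔣 : ConeFrame L H (cmPlace L ι))
      (μ : Measure (adelicGroupData (↥(maximalRealSubfield L)) L (IsCMField.complexConj L) 2 H).automorphicQuotient)
      [(adelicGroupData (↥(maximalRealSubfield L)) L (IsCMField.complexConj L) 2 H).IsAutomorphicMeasure μ]
      -- the ω-side data: reindexing, the LABEL `λ` (conjugate symplectic, weight one), line, central character
      {n' : ℕ} (e₁ : Fin 2 × Fin 1 ≃ Fin n')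
      (lam : Literature.NumberTheory.Automorphic.IdeleClassGroup L →ₜ* Circle) (hlam : IsConjugateSymplectic L lam), HasWeight L lam 1 →
    ∀ (a : (↥(maximalRealSubfield L))ˣ) (χ : Chi (↥(maximalRealSubfield L)) L (IsCMField.complexConj L))
      (W : Type) [AddCommGroup W] [Module ℂ W]
      (σ : Representation ℂ (finAdelic (↥(maximalRealSubfield L)) L (IsCMField.complexConj L) 2 H) W),
      σ.IsIrreducible → σ.IsSmooth →
    ∀ j : σ.IntertwiningMap
        ((rhoVAtLine (↥(maximalRealSubfield L)) L (IsCMField.complexConj L) 2 e₁ (Matrix.diagonal dV)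
            (complexConj_imagUnit L) (imagUnit_ne_zero L) (imagUnit_mul_self L) (realDiagonal_isSymm L dV hdV)
            (isUnit_det_realDiagonal L dV hdV hdV0) (realDiagonal_map L dV hdV).symm
            (fun a => isCompatible_chiSplittingLine L e₁ dV hdV hdV0 (toHeckeCharacter L lam)
              (isUnitary_toHeckeCharacter L lam) ((isOscillatorChar_toHeckeCharacter_iff lam).mpr hlam)
              (TW (↥(maximalRealSubfield L)) a) (isSymm_TW (↥(maximalRealSubfield L)) a)
              (isUnit_det_TW (↥(maximalRealSubfield L)) a) (JW (↥(maximalRealSubfield L)) L a)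
              (JW_eq (↥(maximalRealSubfield L)) L a)) a χ).comp
          (finAdelicCongr (↥(maximalRealSubfield L)) L (IsCMField.complexConj L) g ht hg).symm.toMonoidHom),
      Function.Injective j →
    ∀ P P' : DiscreteAutomorphicRep (adelicGroupData (↥(maximalRealSubfield L)) L (IsCMField.complexConj L) 2 H) μ,
      P.IsHolCotangentAt₂ (IsCMField.complexConj_ne_one L) (UnitaryGroup.complexConj_smul_infinitePlace L) (cmPlace L ι) 𝔣 →
      P'.IsHolCotangentAt₂ (IsCMField.complexConj_ne_one L) (UnitaryGroup.complexConj_smul_infinitePlace L) (cmPlace L ι) 𝔣 →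
      P.HasFinComponent σ → P'.HasFinComponent σ → P = P'

/-- **U** (E1θ₂, Hodge type `(0,1)`) **[Liu2021, Prop. D.4 (1)], «at most one» half, antiholomorphic part** — the statement of `curveThetaCohFinComponentUnique_hol`
with `IsAntiholCotangentAt₂` (archimedean component `π^{(0,1)}_{1,1}`; the non-zero form lies in the `conjFun₂`-image of `holCotForms₂ … 𝔣`); same reading and
citations («`m_disc(π^{(0,1)}_∞ ⊗ ω_f) ≤ 1`»).  Follows from `_hol` by complex conjugation and the conjugate partner of the oscillator carrier ([Liu2021, Lem. D.1 (2)];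
tree ★ `exists_conjPartner_omegaAtLine_neg`).  Restriction of ★ `curveCohFinComponentUnique_antihol` to theta `σ`.
[cite: Liu2021, App. D Prop. D.4 (1) and its proof (p. 130–131); Lem. D.1 (2); Lem. D.2; Rem. D.5] [cite: Rogawski1990, §11.1 Prop. 11.1.1 (a), (b), (d); Prop. 11.2.1 (b); Thm. 11.5.1]
[cite: BorelWallach2000, VII 2.10 and 3.2] [cite: Dixmier1977, §5.4] -/
def curveThetaCohFinComponentUnique_antihol : Prop :=
  ∀ (L : Type) [Field L] [NumberField L] [IsCMField L] (ι : L →+* ℂ) (H : Matrix (Fin 2) (Fin 2) L)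
    (dV : Fin 2 → L) (hdV : ∀ i, IsCMField.complexConj L (dV i) = dV i) (hdV0 : ∀ i, dV i ≠ 0)
    (t : L) (ht : t ≠ 0) (g : GL (Fin 2) L)
    (hg : formCongr ((IsCMField.complexConj L : L ≃ₐ[↥(maximalRealSubfield L)] L) : L →+* L) g (t • H) = Matrix.diagonal dV),
    (∃ T : GL (Fin 2) ℂ, formCongr (starRingEnd ℂ) T ((Matrix.diagonal dV).map ι) = Matrix.diagonal ![(1 : ℂ), -1]) →
    (∀ τ' : L →+* ℂ, InfinitePlace.mk τ' ≠ InfinitePlace.mk ι → ((Matrix.diagonal dV).map τ').PosDef) →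
    4 ≤ Module.finrank ℚ L →
    ∀ (𝔣 : ConeFrame L H (cmPlace L ι))
      (μ : Measure (adelicGroupData (↥(maximalRealSubfield L)) L (IsCMField.complexConj L) 2 H).automorphicQuotient)
      [(adelicGroupData (↥(maximalRealSubfield L)) L (IsCMField.complexConj L) 2 H).IsAutomorphicMeasure μ]
      {n' : ℕ} (e₁ : Fin 2 × Fin 1 ≃ Fin n')
      (lam : Literature.NumberTheory.Automorphic.IdeleClassGroup L →ₜ* Circle) (hlam : IsConjugateSymplectic L lam), HasWeight L lam 1 →
    ∀ (a : (↥(maximalRealSubfield L))ˣ) (χ : Chi (↥(maximalRealSubfield L)) L (IsCMField.complexConj L))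
      (W : Type) [AddCommGroup W] [Module ℂ W]
      (σ : Representation ℂ (finAdelic (↥(maximalRealSubfield L)) L (IsCMField.complexConj L) 2 H) W),
      σ.IsIrreducible → σ.IsSmooth →
    ∀ j : σ.IntertwiningMap
        ((rhoVAtLine (↥(maximalRealSubfield L)) L (IsCMField.complexConj L) 2 e₁ (Matrix.diagonal dV)
            (complexConj_imagUnit L) (imagUnit_ne_zero L) (imagUnit_mul_self L) (realDiagonal_isSymm L dV hdV)
            (isUnit_det_realDiagonal L dV hdV hdV0) (realDiagonal_map L dV hdV).symm
            (fun a => isCompatible_chiSplittingLine L e₁ dV hdV hdV0 (toHeckeCharacter L lam)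
              (isUnitary_toHeckeCharacter L lam) ((isOscillatorChar_toHeckeCharacter_iff lam).mpr hlam)
              (TW (↥(maximalRealSubfield L)) a) (isSymm_TW (↥(maximalRealSubfield L)) a)
              (isUnit_det_TW (↥(maximalRealSubfield L)) a) (JW (↥(maximalRealSubfield L)) L a)
              (JW_eq (↥(maximalRealSubfield L)) L a)) a χ).comp
          (finAdelicCongr (↥(maximalRealSubfield L)) L (IsCMField.complexConj L) g ht hg).symm.toMonoidHom),
      Function.Injective j →
    ∀ P P' : DiscreteAutomorphicRep (adelicGroupData (↥(maximalRealSubfield L)) L (IsCMField.complexConj L) 2 H) μ,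
      P.IsAntiholCotangentAt₂ (IsCMField.complexConj_ne_one L) (UnitaryGroup.complexConj_smul_infinitePlace L) (cmPlace L ι) 𝔣 →
      P'.IsAntiholCotangentAt₂ (IsCMField.complexConj_ne_one L) (UnitaryGroup.complexConj_smul_infinitePlace L) (cmPlace L ι) 𝔣 →
      P.HasFinComponent σ → P'.HasFinComponent σ → P = P'

end Literature.NumberTheory.Rogawski1990

end
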